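import Summits.CriticalPhenomena.PercolationContinuityZ3.Theorems.PercNearOneGluingNoHeavyQuantTorqueSplitRoutes
import HarnessLib

/-!
# QUANT lane R8, T-DEC: TWO LOW ATOMS WITH A SHARED COSTLY ABSORBER — the WATER-FILLING transport under Hall's conditions on `{0..6}`
# (arm-1 gen 55, architect)

builds on p205010 (kernel theorem, internal audit signed; external expert review pending)

Support file (`--supports stmt-CriticalPhenomena-4575`), QUANT lane seat prim-quant-arm-1 (gen 55, architect); memo
`run/shared/lean/prim/quant/prim-quant-arm-1-g55/ARCH-G55.md`.  Theorems only, standard axioms, no sorries.  Over `decAt_all_of_split12` (`…QuantTorqueSplitRoutes`,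
this seat):

* **`decAt_all_of_hall12`** (`4 < T < 6`, `6y ≤ T`): the WATER-FILLING transport (`1` fills `5` then `6`; `2` fills `3`, `4` then `6`) built from
  Hall's three capacity conditions on the shared absorber `6` and three torque-cost conditions — the form in which the three-2-chains
  certificate (`…QuantTripleTwoChain`) discharges regimes `4 < T ≤ 24/5` (capacity `c₃ = (6−T)μ₃/T` on `3`) and `24/5 ≤ T < 6` (`c₃ = 0`).

HONEST STATUS.  Pure bookkeeping (sufficient conditions for the torque-cost criterion); `SiblingStep`, `GateStepN`, `LightResidDECOracle`,
`FarTreeRow` OPEN; RATE class (log\*) / honest sentence of `run/shared/lean/prim/quant/README.md` unchanged.  [this work].  Nothing here is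
cited as a published result.  The gluing rows served [cite: KozmaNitzan2024, Conjecture 3 (p. 15)]; product measure [cite: Grimmett1999, §1.3 p. 10].
-/

noncomputable section

open scoped BigOperators

namespace Summit.CriticalPhenomena.PercolationContinuityZ3.Theorems
namespace Quant
namespace LawDec

open Finset

/-! ### Water-filling under Hall's conditions -/

/-- **WATER-FILLING UNDER HALL'S CONDITIONS (`4 < T < 6`, `6y ≤ T`, laws on `{0..6}`).**  With `κ = T/(6−T)` (an upper bound for every
layer-free rate used, `freeRate_le_sixth`) and capacities in units of low mass `c₅ = (6−T)μ₅/T`, `c₄ = (6−T)μ₄/T`, `c₆ = (6−T)μ₆/T` and a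
prescribed `c₃ ≥ 0` on the absorber `3` (`c₃ = 0`, or `T ≤ 24/5` and `κ·c₃ ≤ μ₃`), let `U = μ₁ − c₅`, `V = μ₂ − c₃ − c₄`,
`R = (T−2)μ₂ + (T−3)μ₃ + (T−4)μ₄`.  If (Hall, shared absorber `6`) `U ≤ c₆`, `V ≤ c₆`, `U + V ≤ c₆` and (torque cost) `U ≤ R`, `T·V ≤ R`,
`U + T·V ≤ R` — all six stated multiplied through by `T` — then the law is DEC at every layer below the top: the transport "`1` fills `5` then
`6`; `2` fills `3`, `4` then `6`" satisfies `decAt_all_of_split12`. [this work] -/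
theorem decAt_all_of_hall12 (y : ℝ) (μ : ℕ → ℝ) (T c₃ : ℝ) (hy0 : 0 < y) (hy1 : y < 1)
    (hμ0 : ∀ h, 0 ≤ μ h) (hμM : ∀ h, 6 < h → μ h = 0) (hμ1 : ∑ h ∈ Finset.range (6 + 1), μ h = 1)
    (hT : ∑ h ∈ Finset.range (6 + 1), (h : ℝ) * μ h = T) (hT4 : 4 < T) (hT6 : T < 6) (hyT : 6 * y ≤ T)
    (hc₃0 : 0 ≤ c₃) (hc₃ : c₃ = 0 ∨ (5 * T ≤ 24 ∧ T * c₃ ≤ (6 - T) * μ 3))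
    (hU6 : T * μ 1 ≤ (6 - T) * (μ 5 + μ 6))
    (hV6 : T * μ 2 ≤ T * c₃ + (6 - T) * (μ 4 + μ 6))
    (hUV6 : T * (μ 1 + μ 2) ≤ T * c₃ + (6 - T) * (μ 4 + μ 5 + μ 6))
    (hUR : T * μ 1 - (6 - T) * μ 5 ≤ T * ((T - 2) * μ 2 + (T - 3) * μ 3 + (T - 4) * μ 4))
    (hWR : T * μ 2 - T * c₃ - (6 - T) * μ 4 ≤ (T - 2) * μ 2 + (T - 3) * μ 3 + (T - 4) * μ 4)
    (hUWR : T * μ 1 - (6 - T) * μ 5 + T * (T * μ 2 - T * c₃ - (6 - T) * μ 4)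
      ≤ T * ((T - 2) * μ 2 + (T - 3) * μ 3 + (T - 4) * μ 4)) :
    ∀ j', j' < 6 → DECAt y j' 6 μ := by
  have hT0 : 0 < T := by linarith
  have h6T : 0 < 6 - T := by linarith
  have hy6 : y < 1 := hy1
  set κ : ℝ := T / (6 - T) with hκ
  set R : ℝ := (T - 2) * μ 2 + (T - 3) * μ 3 + (T - 4) * μ 4 with hR
  set c₅ : ℝ := (6 - T) * μ 5 / T with hc₅
  set c₄ : ℝ := (6 - T) * μ 4 / T with hc₄
  set c₆ : ℝ := (6 - T) * μ 6 / T with hc₆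
  have hc₅0 : 0 ≤ c₅ := div_nonneg (mul_nonneg h6T.le (hμ0 5)) hT0.le
  have hc₄0 : 0 ≤ c₄ := div_nonneg (mul_nonneg h6T.le (hμ0 4)) hT0.le
  have hc₆0 : 0 ≤ c₆ := div_nonneg (mul_nonneg h6T.le (hμ0 6)) hT0.le
  have hTc₅ : T * c₅ = (6 - T) * μ 5 := by rw [hc₅]; field_simp
  have hTc₄ : T * c₄ = (6 - T) * μ 4 := by rw [hc₄]; field_simp
  have hTc₆ : T * c₆ = (6 - T) * μ 6 := by rw [hc₆]; field_simp
  have hκT : (6 - T) * κ = T := by rw [hκ]; field_simp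
  have hκ0 : 0 ≤ κ := div_nonneg hT0.le h6T.le
  have hκc₅ : κ * c₅ = μ 5 := by
    have e : (6 - T) * (κ * c₅) = (6 - T) * μ 5 := by rw [← mul_assoc, hκT, hTc₅]
    exact mul_left_cancel₀ h6T.ne' e
  have hκc₄ : κ * c₄ = μ 4 := by
    have e : (6 - T) * (κ * c₄) = (6 - T) * μ 4 := by rw [← mul_assoc, hκT, hTc₄]
    exact mul_left_cancel₀ h6T.ne' e
  have hκc₆ : κ * c₆ = μ 6 := by
    have e : (6 - T) * (κ * c₆) = (6 - T) * μ 6 := by rw [← mul_assoc, hκT, hTc₆]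
    exact mul_left_cancel₀ h6T.ne' e
  have hci : (5 - T) * κ ≤ T - 1 := by
    have e : (6 - T) * ((5 - T) * κ) = (5 - T) * T := by
      calc (6 - T) * ((5 - T) * κ) = (5 - T) * ((6 - T) * κ) := by ring
        _ = (5 - T) * T := by rw [hκT]
    have h2 : (6 - T) * ((5 - T) * κ) ≤ (6 - T) * (T - 1) := by rw [e]; nlinarith
    exact le_of_mul_le_mul_left h2 h6T
  -- Hall / cost conditions in units of low mass (divide the hypotheses by `T`)
  have hU6' : μ 1 - c₅ ≤ c₆ := by
    refine le_of_mul_le_mul_left ?_ hT0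
    have : T * (μ 1 - c₅) = T * μ 1 - T * c₅ := by ring
    linarith
  have hV6' : μ 2 - c₃ - c₄ ≤ c₆ := by
    refine le_of_mul_le_mul_left ?_ hT0
    have : T * (μ 2 - c₃ - c₄) = T * μ 2 - T * c₃ - T * c₄ := by ring
    linarith
  have hUV6' : (μ 1 - c₅) + (μ 2 - c₃ - c₄) ≤ c₆ := by
    refine le_of_mul_le_mul_left ?_ hT0
    have : T * ((μ 1 - c₅) + (μ 2 - c₃ - c₄)) = T * μ 1 + T * μ 2 - T * c₃ - T * c₅ - T * c₄ := by ring
    have : T * (μ 1 + μ 2) = T * μ 1 + T * μ 2 := by ring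
    linarith
  have hUR' : μ 1 - c₅ ≤ R := by
    refine le_of_mul_le_mul_left ?_ hT0
    have : T * (μ 1 - c₅) = T * μ 1 - T * c₅ := by ring
    linarith
  have hTV : T * (μ 2 - c₃ - c₄) = T * μ 2 - T * c₃ - (6 - T) * μ 4 := by
    have : T * (μ 2 - c₃ - c₄) = T * μ 2 - T * c₃ - T * c₄ := by ring
    linarith
  have hWR' : T * (μ 2 - c₃ - c₄) ≤ R := by rw [hTV]; exact hWR
  have hUWR' : (μ 1 - c₅) + T * (μ 2 - c₃ - c₄) ≤ R := by
    refine le_of_mul_le_mul_left ?_ hT0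
    rw [hTV]
    have : T * (μ 1 - c₅ + (T * μ 2 - T * c₃ - (6 - T) * μ 4)) = T * μ 1 - T * c₅ + T * (T * μ 2 - T * c₃ - (6 - T) * μ 4) := by
      ring
    linarith
  have hR0 : 0 ≤ R :=
    add_nonneg (add_nonneg (mul_nonneg (by linarith) (hμ0 2)) (mul_nonneg (by linarith) (hμ0 3))) (mul_nonneg (by linarith) (hμ0 4))
  -- the water-filling flows
  set x₁₅ : ℝ := min (μ 1) c₅ with hx₁₅
  set x₁₆ : ℝ := μ 1 - x₁₅ with hx₁₆
  set x₂₃ : ℝ := min (μ 2) c₃ with hx₂₃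
  set x₂₄ : ℝ := min (μ 2 - x₂₃) c₄ with hx₂₄
  set x₂₆ : ℝ := μ 2 - x₂₃ - x₂₄ with hx₂₆
  have h15 : 0 ≤ x₁₅ := le_min (hμ0 1) hc₅0
  have h15le : x₁₅ ≤ μ 1 := min_le_left _ _
  have h16 : 0 ≤ x₁₆ := by rw [hx₁₆]; linarith
  have h23 : 0 ≤ x₂₃ := le_min (hμ0 2) hc₃0
  have h23le : x₂₃ ≤ μ 2 := min_le_left _ _
  have h24 : 0 ≤ x₂₄ := le_min (by linarith) hc₄0
  have h24le : x₂₄ ≤ μ 2 - x₂₃ := min_le_left _ _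
  have h26 : 0 ≤ x₂₆ := by rw [hx₂₆]; linarith
  -- the two overflow dichotomies
  have hover1 : x₁₆ = 0 ∨ (x₁₆ = μ 1 - c₅ ∧ c₅ ≤ μ 1) := by
    rcases le_total (μ 1) c₅ with hle | hle
    · left; rw [hx₁₆, hx₁₅, min_eq_left hle, sub_self]
    · right; exact ⟨by rw [hx₁₆, hx₁₅, min_eq_right hle], hle⟩
  have hover2 : x₂₆ = 0 ∨ (x₂₆ = μ 2 - c₃ - c₄ ∧ c₃ + c₄ ≤ μ 2) := by
    rcases le_total (μ 2) c₃ with hle | hle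
    · left
      have e23 : x₂₃ = μ 2 := by rw [hx₂₃, min_eq_left hle]
      have e24 : x₂₄ = 0 := by rw [hx₂₄, e23, sub_self, min_eq_left hc₄0]
      rw [hx₂₆, e23, e24]; ring
    · have e23 : x₂₃ = c₃ := by rw [hx₂₃, min_eq_right hle]
      rcases le_total (μ 2 - c₃) c₄ with hle' | hle'
      · left
        have e24 : x₂₄ = μ 2 - c₃ := by rw [hx₂₄, e23, min_eq_left hle']
        rw [hx₂₆, e23, e24]; ring
      · right
        have e24 : x₂₄ = c₄ := by rw [hx₂₄, e23, min_eq_right hle']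
        refine ⟨by rw [hx₂₆, e23, e24], by linarith⟩
  -- rates are at most κ on every route used
  have hr15 : freeRate y T 1 5 ≤ κ := freeRate_le_sixth y T 1 5 hyT (by push_cast; linarith) hT6
  have hr16 : freeRate y T 1 6 ≤ κ := freeRate_le_sixth y T 1 6 hyT (by push_cast; linarith) hT6
  have hr24 : freeRate y T 2 4 ≤ κ := freeRate_le_sixth y T 2 4 hyT (by push_cast; linarith) hT6
  have hr26 : freeRate y T 2 6 ≤ κ := freeRate_le_sixth y T 2 6 hyT (by push_cast; linarith) hT6
  refine decAt_all_of_split12 y x₁₅ x₁₆ x₂₃ x₂₄ x₂₆ μ T hy0 hy1 hμ0 hμM hμ1 hT hT4 hT6 (by push_cast; linarith)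
    h15 h16 h23 h24 h26 (by rw [hx₁₆]; ring) (by rw [hx₂₆]; ring) ?_ ?_ ?_ ?_ ?_ ?_
  · -- the route 2 → 3 carries flow only while T ≤ 24/5
    intro hpos
    rcases hc₃ with hz | ⟨h245, _⟩
    · exfalso
      have : x₂₃ = 0 := by rw [hx₂₃, hz, min_eq_right (hμ0 2)]
      linarith
    · linarith
  · -- capacity of 3
    rcases hc₃ with hz | ⟨h245, hcap⟩
    · have : x₂₃ = 0 := by rw [hx₂₃, hz, min_eq_right (hμ0 2)]
      rw [this, mul_zero]; exact hμ0 3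
    · have hr23 : freeRate y T 2 3 ≤ κ := freeRate_le_sixth y T 2 3 hyT (by push_cast; linarith) hT6
      have hκc₃ : κ * c₃ ≤ μ 3 := by
        rw [hκ, div_mul_eq_mul_div, div_le_iff₀ h6T]; linarith
      calc freeRate y T 2 3 * x₂₃ ≤ κ * x₂₃ := mul_le_mul_of_nonneg_right hr23 h23
        _ ≤ κ * c₃ := mul_le_mul_of_nonneg_left (min_le_right _ _) hκ0
        _ ≤ μ 3 := hκc₃
  · -- capacity of 4
    calc freeRate y T 2 4 * x₂₄ ≤ κ * x₂₄ := mul_le_mul_of_nonneg_right hr24 h24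
      _ ≤ κ * c₄ := mul_le_mul_of_nonneg_left (min_le_right _ _) hκ0
      _ = μ 4 := hκc₄
  · -- capacity of 5
    calc freeRate y T 1 5 * x₁₅ ≤ κ * x₁₅ := mul_le_mul_of_nonneg_right hr15 h15
      _ ≤ κ * c₅ := mul_le_mul_of_nonneg_left (min_le_right _ _) hκ0
      _ = μ 5 := hκc₅
  · -- the shared absorber 6 (Hall)
    have hsum : x₁₆ + x₂₆ ≤ c₆ := by
      rcases hover1 with e1 | ⟨e1, _⟩ <;> rcases hover2 with e2 | ⟨e2, _⟩ <;> rw [e1, e2] <;> linarith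
    calc freeRate y T 1 6 * x₁₆ + freeRate y T 2 6 * x₂₆ ≤ κ * x₁₆ + κ * x₂₆ :=
          add_le_add (mul_le_mul_of_nonneg_right hr16 h16) (mul_le_mul_of_nonneg_right hr26 h26)
      _ = κ * (x₁₆ + x₂₆) := by ring
      _ ≤ κ * c₆ := mul_le_mul_of_nonneg_left hsum hκ0
      _ = μ 6 := hκc₆
  · -- torque cost
    have hfirst : (if T < 5 then (5 - T) * (freeRate y T 1 5 * x₁₅) else 0) ≤ (T - 1) * x₁₅ := by
      split_ifs with h5
      · calc (5 - T) * (freeRate y T 1 5 * x₁₅) ≤ (5 - T) * (κ * x₁₅) :=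
              mul_le_mul_of_nonneg_left (mul_le_mul_of_nonneg_right hr15 h15) (by linarith)
          _ = ((5 - T) * κ) * x₁₅ := by ring
          _ ≤ (T - 1) * x₁₅ := mul_le_mul_of_nonneg_right hci h15
      · exact mul_nonneg (by linarith) h15
    have hsecond : (6 - T) * (freeRate y T 1 6 * x₁₆ + freeRate y T 2 6 * x₂₆) ≤ T * (x₁₆ + x₂₆) := by
      calc (6 - T) * (freeRate y T 1 6 * x₁₆ + freeRate y T 2 6 * x₂₆) ≤ (6 - T) * (κ * x₁₆ + κ * x₂₆) :=
            mul_le_mul_of_nonneg_left (add_le_add (mul_le_mul_of_nonneg_right hr16 h16)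
              (mul_le_mul_of_nonneg_right hr26 h26)) h6T.le
        _ = ((6 - T) * κ) * (x₁₆ + x₂₆) := by ring
        _ = T * (x₁₆ + x₂₆) := by rw [hκT]
    have hbudget : (T - 1) * μ 1 + R ≤ ∑ l ∈ Finset.range (6 + 1), (if (1 ≤ l ∧ (l : ℝ) < T) then μ l * (T - l) else 0) := by
      simp only [Finset.sum_range_succ, Finset.sum_range_zero]
      norm_num
      rw [if_pos (by linarith : (1 : ℝ) < T), if_pos (by linarith : (2 : ℝ) < T), if_pos (by linarith : (3 : ℝ) < T),
        if_pos (by linarith : (4 : ℝ) < T)]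
      have h5 : 0 ≤ (if (5 : ℝ) < T then μ 5 * (T - 5) else 0) := by
        split_ifs with h
        · exact mul_nonneg (hμ0 5) (by linarith)
        · exact le_rfl
      have h6 : 0 ≤ (if (6 : ℝ) < T then μ 6 * (T - 6) else 0) := by
        split_ifs with h
        · exact mul_nonneg (hμ0 6) (by linarith)
        · exact le_rfl
      rw [hR]; linarith
    have hkey : x₁₆ + T * x₂₆ ≤ R := by
      rcases hover1 with e1 | ⟨e1, _⟩ <;> rcases hover2 with e2 | ⟨e2, _⟩ <;> rw [e1, e2]
      · simpa using hR0
      · simpa using hWR'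
      · simpa using hUR'
      · exact hUWR'
    have e15 : (T - 1) * x₁₅ + T * (x₁₆ + x₂₆) ≤ (T - 1) * μ 1 + R := by
      have : μ 1 = x₁₅ + x₁₆ := by rw [hx₁₆]; ring
      rw [this]
      have e : (T - 1) * (x₁₅ + x₁₆) + R - ((T - 1) * x₁₅ + T * (x₁₆ + x₂₆)) = R - (x₁₆ + T * x₂₆) := by ring
      linarith
    linarith



end LawDec
end Quant
end Summit.CriticalPhenomena.PercolationContinuityZ3.Theorems
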